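import Mathlib
import Literature.Analysis.ODE.InverseSquareLadderPreimageVanishing
import Literature.Analysis.ODE.InverseSquareLadderCoercivity
import Literature.Analysis.ODE.InverseSquareLadderMonomials
import Literature.Analysis.PDE.InverseSquareChannelIdentityReversed
import Literature.Analysis.PDE.DAlembertSmooth
import Literature.Analysis.Calculus.TaylorJet
import HarnessLib

/-!
# The exact inverse-square channel inequality for compactly supported `C² × C¹` data

Analysis/PDE support file (everything proved, no definitions). Packaging of the exact-theory bricks
of the far-side channel estimate (ladder preimages, d'Alembert, ladder waves, channel-limit identities,
Hardy-chain coercivity, Taylor jets, ladder of Taylor sums): for `ι` smooth with `ι = 1/x` on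
`[½,∞)`, a smooth primitive `I`, `n : ℕ`, there is `C = C(n, ι) ≥ 0` such that for all data
`h ∈ C²`, `g ∈ C¹` vanishing on `[B, ∞)` and `1 ≤ R ≤ B` there are
* an exact `C²` wave `ψ₀` of `ψ_tt − ψ_xx + n(n+1)ι²ψ = 0` on `x > ½` with Cauchy data `(h, g)`,
* its outgoing / incoming channel energies `Lp = lim_{t→+∞} ∫_{x>R+t} e₀[ψ₀](t)`,
  `Lm = lim_{t→−∞} ∫_{x>R−t} e₀[ψ₀](t)` (genuine limits),
* kernel coefficients `α, β` (data of the `t`-polynomial solutions: even inverse powers `ι^{n−2k}`),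
with, for every `X ≥ R`,

  `∫_R^X ((h − Σα_kι^{n−2k})')² + n(n+1)ι²(h − Σα_kι^{n−2k})² + (g − Σβ_kι^{n−2k})² ≤ C (Lp + Lm)`

(`exists_exactWave_channel_bound`). This is the 1D (Regge–Wheeler variable) form of the exterior
channel-of-energy estimate for radial free waves in odd dimension `d = 2n+3` modulo its
non-radiative kernel (Kenig–Lawrie–Liu–Schlag, Adv. Math. 285 (2015), Thm. 5), for compactly
supported data; the far half of `FixedModeChannels` (route PhotonSphereChannels,
stmt-FinalStateConjecture-10048) follows by cutoff density and a Duhamel comparison.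
-/

noncomputable section

namespace Literature.Analysis.PDE

open MeasureTheory Set Filter Topology Finset intervalIntegral Literature.Analysis.ODE
  Literature.Analysis.Calculus

/-! ### Calculus helpers -/

/-- A Taylor sum of degree `< M` has vanishing derivatives of order `N ≥ M`. [folklore] -/
theorem iteratedDeriv_taylorSum_eq_zero (c : ℕ → ℝ) {M N : ℕ} (hMN : M ≤ N) (R x : ℝ) :
    iteratedDeriv N (fun y : ℝ => ∑ m ∈ range M, c m * (y - R) ^ m) x = 0 := by
  have hsmooth : ∀ m ∈ range M, ContDiffAt ℝ N (fun y : ℝ => c m * (y - R) ^ m) x := fun m _ =>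
    (contDiff_const.mul ((contDiff_id.sub contDiff_const).pow m)).contDiffAt
  rw [iteratedDeriv_fun_sum hsmooth]
  refine Finset.sum_eq_zero fun m hm => ?_
  have hmN : m < N := lt_of_lt_of_le (mem_range.1 hm) hMN
  rw [iteratedDeriv_const_mul _ (((contDiff_id.sub contDiff_const).pow m).contDiffAt)]
  have h := congrFun (iteratedDeriv_comp_sub_const (n := N) (f := fun y : ℝ => y ^ m) (s := R)) x
  rw [h, iteratedDeriv_pow, Nat.descFactorial_eq_zero_iff_lt.2 hmN]
  simp

/-- If `F ∈ C^{k+1}` is constant on `[B, ∞)` then `F^{(k+1)}` vanishes on `[B, ∞)`. [folklore] -/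
theorem iteratedDeriv_succ_eq_zero_of_const_Ici {F : ℝ → ℝ} {k : ℕ} (hF : ContDiff ℝ (k + 2) F)
    {B : ℝ} (hFB : ∀ x, B ≤ x → F x = F B) : ∀ x, B ≤ x → iteratedDeriv (k + 1) F x = 0 := by
  have hopen : ∀ x, B < x → iteratedDeriv (k + 1) F x = 0 := by
    intro x hx
    have hev : F =ᶠ[𝓝 x] fun _ => F B :=
      Filter.mem_of_superset (Ioi_mem_nhds hx) fun y hy => hFB y (le_of_lt hy)
    rw [hev.iteratedDeriv_eq, iteratedDeriv_const]
    simp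
  have hcont : Continuous (iteratedDeriv (k + 1) F) :=
    hF.continuous_iteratedDeriv _ (by push_cast; gcongr; norm_num)
  intro x hx
  rcases lt_or_eq_of_le hx with hlt | heq
  · exact hopen x hlt
  · subst heq
    -- value at the endpoint by continuity from the right
    have h1 : Tendsto (iteratedDeriv (k + 1) F) (𝓝[>] B) (𝓝 (iteratedDeriv (k + 1) F B)) :=
      hcont.continuousAt.continuousWithinAt.tendsto
    have h2 : Tendsto (iteratedDeriv (k + 1) F) (𝓝[>] B) (𝓝 0) := by
      refine tendsto_const_nhds.congr' ?_
      exact Filter.mem_of_superset self_mem_nhdsWithin fun y hy => (hopen y hy).symm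
    exact tendsto_nhds_unique h1 h2

/-- Interval integrals of a non-negative continuous function vanishing on `[B, ∞)` are maximal at
`B`: `∫_R^X f ≤ ∫_R^B f` for `R ≤ B`, `R ≤ X`. [folklore] -/
theorem intervalIntegral_le_of_zero_Ici {f : ℝ → ℝ} (hf : Continuous f) (hf0 : ∀ x, 0 ≤ f x)
    {R B X : ℝ} (hRX : R ≤ X) (hfB : ∀ x, B ≤ x → f x = 0) :
    ∫ x in R..X, f x ≤ ∫ x in R..B, f x := by
  rcases le_or_gt X B with hXB | hXB
  · exact intervalIntegral.integral_mono_interval le_rfl hRX hXB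
      (Eventually.of_forall hf0) (hf.intervalIntegrable _ _)
  · have hsplit : ∫ x in R..X, f x = (∫ x in R..B, f x) + ∫ x in B..X, f x :=
      (intervalIntegral.integral_add_adjacent_intervals (hf.intervalIntegrable _ _)
        (hf.intervalIntegrable _ _)).symm
    have hzero : ∫ x in B..X, f x = 0 := by
      rw [intervalIntegral.integral_congr (g := fun _ => (0 : ℝ)) fun x hx => ?_]
      · simp
      · rw [uIcc_of_le hXB.le] at hx
        exact hfB x hx.1
    rw [hsplit, hzero, add_zero]

/-- A function with vanishing derivative on `[B, ∞)` is constant there. [folklore] -/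
theorem eq_on_Ici_of_deriv_eq_zero {f : ℝ → ℝ} (hf : Differentiable ℝ f) (hf' : Continuous (deriv f))
    {B : ℝ} (h0 : ∀ x, B ≤ x → deriv f x = 0) : ∀ x, B ≤ x → f x = f B := by
  intro x hx
  have hftc := intervalIntegral.integral_eq_sub_of_hasDerivAt (a := B) (b := x)
    (fun y _ => (hf y).hasDerivAt) (hf'.intervalIntegrable _ _)
  have hzero : ∫ y in B..x, deriv f y = 0 := by
    rw [intervalIntegral.integral_congr (g := fun _ => (0 : ℝ)) fun y hy => ?_]
    · simp
    · rw [uIcc_of_le hx] at hy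
      exact h0 y hy.1
  rw [hzero] at hftc
  linarith

/-! ### The packaged exact channel inequality -/

section Main

variable {ι I : ℝ → ℝ}

/-- **Exact inverse-square channel inequality for compactly supported data.** See the module
docstring. [cite: KenigEtAl2015, Theorem 5 (exterior energy estimate, radial odd d)] -/
theorem exists_exactWave_channel_bound (hι : ContDiff ℝ (⊤ : ℕ∞) ι)
    (hιeq : ∀ x : ℝ, 1 / 2 ≤ x → ι x = x⁻¹) (hric : ∀ x ∈ Ioi (1 / 2 : ℝ), deriv ι x = -(ι x) ^ 2)
    (hI : ContDiff ℝ (⊤ : ℕ∞) I) (hI' : ∀ x, HasDerivAt I (ι x) x) (n : ℕ) :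
    ∃ C : ℝ, 0 ≤ C ∧ ∀ (h g : ℝ → ℝ) (R B : ℝ), ContDiff ℝ 2 h → ContDiff ℝ 1 g → 1 ≤ R → R ≤ B →
      (∀ x, B ≤ x → h x = 0) → (∀ x, B ≤ x → g x = 0) →
      ∃ ψ₀ : ℝ → ℝ → ℝ, ContDiff ℝ 2 (Function.uncurry ψ₀) ∧
        (∀ t, ∀ x ∈ Ioi (1 / 2 : ℝ), iteratedDeriv 2 (fun τ => ψ₀ τ x) t
          = iteratedDeriv 2 (ψ₀ t) x - n * (n + 1) * ι x ^ 2 * ψ₀ t x) ∧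
        (∀ x, ψ₀ 0 x = h x) ∧ (∀ x, deriv (fun τ => ψ₀ τ x) 0 = g x) ∧
        ∃ Lp Lm : ℝ, 0 ≤ Lp ∧ 0 ≤ Lm ∧
          Tendsto (fun t => ∫ x in Ioi (R + t), (deriv (fun τ => ψ₀ τ x) t ^ 2
            + deriv (ψ₀ t) x ^ 2 + (n : ℝ) * (n + 1) * ι x ^ 2 * ψ₀ t x ^ 2)) atTop (𝓝 Lp) ∧
          Tendsto (fun t => ∫ x in Ioi (R - t), (deriv (fun τ => ψ₀ τ x) t ^ 2
            + deriv (ψ₀ t) x ^ 2 + (n : ℝ) * (n + 1) * ι x ^ 2 * ψ₀ t x ^ 2)) atBot (𝓝 Lm) ∧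
          ∃ α β : ℕ → ℝ, ∀ X, R ≤ X →
            ∫ x in R..X, (deriv (fun y => h y - ∑ k ∈ range (n / 2 + 1), α k * ι y ^ (n - 2 * k)) x ^ 2
              + (n : ℝ) * (n + 1) * ι x ^ 2
                * (h x - ∑ k ∈ range (n / 2 + 1), α k * ι x ^ (n - 2 * k)) ^ 2
              + (g x - ∑ k ∈ range ((n + 1) / 2), β k * ι x ^ (n - 2 * k)) ^ 2)
            ≤ C * (Lp + Lm) := by
  obtain ⟨C₁, hC₁0, hC₁⟩ := exists_ladder_energy_integral_le hι hιeq n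
  obtain ⟨C₂, hC₂0, hC₂⟩ := exists_ladder_sq_integral_le hι hιeq n
  refine ⟨C₁ + C₂, by positivity, ?_⟩
  intro h g R B hh hg hR hRB hhB hgB
  -- Step 1: ladder preimages of the data, vanishing on `[B, ∞)`
  obtain ⟨u, huC, hlu, huB⟩ :=
    exists_ladder_preimage_vanishing hI hI' B n (m := 2) (w := h) (by exact_mod_cast hh) hhB
  obtain ⟨v, hvC, hlv, hvB⟩ :=
    exists_ladder_preimage_vanishing hI hI' B n (m := 1) (w := g) (by exact_mod_cast hg) hgB
  have huC' : ContDiff ℝ (n + 2) u := by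
    have : ((2 + n : ℕ) : ℕ∞) = ((n + 2 : ℕ) : ℕ∞) := by rw [add_comm]
    rw [this] at huC; exact_mod_cast huC
  have hvC' : ContDiff ℝ (n + 1) v := by
    have : ((1 + n : ℕ) : ℕ∞) = ((n + 1 : ℕ) : ℕ∞) := by rw [add_comm]
    rw [this] at hvC; exact_mod_cast hvC
  -- Step 2: d'Alembert for the profiles `(u, v)`
  obtain ⟨Φ, F, G, hΦC, hFC, hGC, hΦ, hFG, hGF', hfree, hΦ0, hΦt0, -, -⟩ :=
    exists_dAlembert_solution_contDiff (n := n) huC' hvC'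
  -- `F, G` are constant beyond `B`
  have h12 : (1 : WithTop ℕ∞) ≤ (n : WithTop ℕ∞) + 2 := le_trans (by norm_num) le_add_self
  have h02 : (n : WithTop ℕ∞) + 2 ≠ 0 := ne_of_gt (lt_of_lt_of_le (by norm_num) le_add_self)
  have hFd : Differentiable ℝ F := hFC.differentiable h02
  have hGd : Differentiable ℝ G := hGC.differentiable h02
  have hF'c : Continuous (deriv F) := hFC.continuous_deriv h12
  have hG'c : Continuous (deriv G) := hGC.continuous_deriv h12
  have hGF : ∀ x, B ≤ x → G x - F x = G B - F B := by
    refine eq_on_Ici_of_deriv_eq_zero (f := fun x => G x - F x) (hGd.sub hFd) ?_ fun x hx => ?_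
    · have : deriv (fun x => G x - F x) = fun x => deriv G x - deriv F x :=
        funext fun x => deriv_fun_sub (hGd x) (hFd x)
      rw [this]; exact hG'c.sub hF'c
    · rw [deriv_fun_sub (hGd x) (hFd x), hGF' x, hvB x hx]
  have hFB : ∀ x, B ≤ x → F x = F B := by
    intro x hx
    have h1 := hFG x; have h2 := hFG B; have h3 := hGF x hx
    rw [huB x hx] at h1; rw [huB B le_rfl] at h2
    linarith
  have hGB : ∀ x, B ≤ x → G x = -F B := by
    intro x hx
    have h1 := hFG x; rw [huB x hx, hFB x hx] at h1; linarith
  -- Step 3: the exact wave `ψ₀ = ladder ι n (Φ t)`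
  have hΦC' : ContDiff ℝ ((n + 2 : ℕ) : ℕ∞) (Function.uncurry Φ) := by exact_mod_cast hΦC
  obtain ⟨hψC, hψeq⟩ := ladder_wave hι isOpen_Ioi hric (n := n) hΦC' hfree
  refine ⟨fun t => ladder ι n (Φ t), hψC, hψeq, fun x => ?_, fun x => ?_, ?_⟩
  · have hΦ0' : Φ 0 = u := funext hΦ0
    show ladder ι n (Φ 0) x = h x
    rw [hΦ0', hlu]
  · rw [(ladder_wave_data hι hΦC' x).2]
    have : (fun y => deriv (fun τ => Φ τ y) 0) = v := funext hΦt0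
    rw [this, hlv]
  -- Step 4: the channel limits
  have hFC' : ContDiff ℝ ((n + 2 : ℕ) : ℕ∞) F := by exact_mod_cast hFC
  have hGC' : ContDiff ℝ ((n + 2 : ℕ) : ℕ∞) G := by exact_mod_cast hGC
  have hlimp := inverseSquare_channel_limit_atTop hι hιeq n hFC' hGC' hR hRB hFB hGB hΦ
  have hlimm := inverseSquare_channel_limit_atBot hι hιeq n hFC' hGC' hR hRB hFB hGB hΦ
  set Lp : ℝ := 2 * ∫ y in R..B, iteratedDeriv (n + 1) F y ^ 2 with hLp
  set Lm : ℝ := 2 * ∫ y in R..B, iteratedDeriv (n + 1) G y ^ 2 with hLm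
  have hLp0 : 0 ≤ Lp := by
    have := intervalIntegral.integral_nonneg (μ := volume) hRB fun y _ => sq_nonneg (iteratedDeriv (n + 1) F y)
    rw [hLp]; positivity
  have hLm0 : 0 ≤ Lm := by
    have := intervalIntegral.integral_nonneg (μ := volume) hRB fun y _ => sq_nonneg (iteratedDeriv (n + 1) G y)
    rw [hLm]; positivity
  refine ⟨Lp, Lm, hLp0, hLm0, hlimp, hlimm, ?_⟩
  -- Step 5: Taylor sums at `R` and their ladders (the kernel data)
  obtain ⟨α, hα⟩ := exists_ladder_taylorSum_eq hι hιeq n (fun m => iteratedDeriv m u R / m.factorial) R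
  obtain ⟨β, hβ⟩ := exists_ladder_taylorSum_lt_eq hι hιeq n (fun m => iteratedDeriv m v R / m.factorial) R
  refine ⟨α, β, fun X hX => ?_⟩
  set T₁ : ℝ → ℝ := fun y => ∑ m ∈ range (n + 1), iteratedDeriv m u R / m.factorial * (y - R) ^ m with hT₁
  set T₂ : ℝ → ℝ := fun y => ∑ m ∈ range n, iteratedDeriv m v R / m.factorial * (y - R) ^ m with hT₂
  set k₁ : ℝ → ℝ := fun y => u y - T₁ y with hk₁
  set k₂ : ℝ → ℝ := fun y => v y - T₂ y with hk₂
  have hT₁C : ∀ {N : ℕ∞}, ContDiff ℝ N T₁ := fun {N} => contDiff_taylorSum _ n R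
  have hT₂C : ∀ {N : ℕ∞}, ContDiff ℝ N T₂ := fun {N} =>
    ContDiff.sum fun m _ => contDiff_const.mul ((contDiff_id.sub contDiff_const).pow m)
  have hk₁C : ContDiff ℝ ((n + 1 : ℕ) : ℕ∞) k₁ :=
    (huC'.of_le (by push_cast; gcongr; norm_num)).sub hT₁C
  have hk₂C : ContDiff ℝ (n : ℕ∞) k₂ := (hvC'.of_le le_self_add).sub hT₂C
  -- jets vanish at `R`
  have hjet₁ : ∀ j ≤ n, iteratedDeriv j k₁ R = 0 := fun j hj =>
    iteratedDeriv_sub_taylorSum (huC'.of_le le_self_add) R hj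
  have hjet₂ : ∀ j < n, iteratedDeriv j k₂ R = 0 := by
    intro j hj
    rcases Nat.eq_zero_or_pos n with hn0 | hnpos
    · omega
    · obtain ⟨n', rfl⟩ : ∃ n', n = n' + 1 := ⟨n - 1, by omega⟩
      exact iteratedDeriv_sub_taylorSum (hvC'.of_le (by push_cast; exact le_trans le_self_add le_self_add))
        R (Nat.lt_succ_iff.1 hj)
  -- coercivity
  have hco₁ := hC₁ k₁ hk₁C R X hR hX hjet₁
  have hco₂ := hC₂ k₂ hk₂C R X hR hX hjet₂
  -- identify the ladders with `h − Σα`, `g − Σβ` on `x > ½`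
  have hlk₁ : ladder ι n k₁ = fun y => h y - ladder ι n T₁ y := by
    rw [hk₁, ladder_sub hι (huC'.of_le le_self_add) hT₁C, hlu]
  have hlk₂ : ladder ι n k₂ = fun y => g y - ladder ι n T₂ y := by
    rw [hk₂, ladder_sub hι (hvC'.of_le le_self_add) hT₂C, hlv]
  have hev₁ : ∀ x, 1 / 2 < x → ladder ι n k₁ =ᶠ[𝓝 x]
      fun y => h y - ∑ k ∈ range (n / 2 + 1), α k * ι y ^ (n - 2 * k) := by
    intro x hx
    rw [hlk₁]
    exact Filter.mem_of_superset (Ioi_mem_nhds hx) fun y hy => by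
      show h y - ladder ι n T₁ y = h y - ∑ k ∈ range (n / 2 + 1), α k * ι y ^ (n - 2 * k)
      rw [hα y hy]
  have hval₂ : ∀ y, 1 / 2 < y → ladder ι n k₂ y = g y - ∑ k ∈ range ((n + 1) / 2), β k * ι y ^ (n - 2 * k) := by
    intro y hy
    rw [hlk₂]
    show g y - ladder ι n T₂ y = _
    rw [hβ y hy]
  -- the higher derivatives of `k₁, k₂` are those of `u, v`, i.e. of `F ± G`
  have hdk₁ : ∀ y, iteratedDeriv (n + 1) k₁ y = iteratedDeriv (n + 1) F y + iteratedDeriv (n + 1) G y := by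
    intro y
    have huFG : u = fun z => F z + G z := funext fun z => (hFG z).symm
    rw [hk₁, iteratedDeriv_fun_sub (huC'.of_le (by push_cast; gcongr; norm_num)).contDiffAt
      hT₁C.contDiffAt, iteratedDeriv_taylorSum_eq_zero _ le_rfl, sub_zero, huFG,
      iteratedDeriv_fun_add (hFC.of_le (by push_cast; gcongr; norm_num)).contDiffAt
        (hGC.of_le (by push_cast; gcongr; norm_num)).contDiffAt]
  have hdk₂ : ∀ y, iteratedDeriv n k₂ y = iteratedDeriv (n + 1) G y - iteratedDeriv (n + 1) F y := by
    intro y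
    have hvd : v = deriv fun z => G z - F z := funext fun z => by
      rw [deriv_fun_sub (hGd z) (hFd z)]; exact (hGF' z).symm
    rw [hk₂, iteratedDeriv_fun_sub (hvC'.of_le le_self_add).contDiffAt
      hT₂C.contDiffAt, iteratedDeriv_taylorSum_eq_zero _ le_rfl, sub_zero, hvd, ← iteratedDeriv_succ',
      iteratedDeriv_fun_sub (hGC.of_le (by push_cast; gcongr; norm_num)).contDiffAt
        (hFC.of_le (by push_cast; gcongr; norm_num)).contDiffAt]
  -- Step 6: the higher derivatives of `F, G` vanish on `[B, ∞)`
  have hGB' : ∀ x, B ≤ x → G x = G B := fun x hx => by rw [hGB x hx, hGB B le_rfl]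
  have hF0 : ∀ x, B ≤ x → iteratedDeriv (n + 1) F x = 0 :=
    iteratedDeriv_succ_eq_zero_of_const_Ici (k := n) hFC hFB
  have hG0 : ∀ x, B ≤ x → iteratedDeriv (n + 1) G x = 0 :=
    iteratedDeriv_succ_eq_zero_of_const_Ici (k := n) hGC hGB'
  have hFc : Continuous fun y => iteratedDeriv (n + 1) F y ^ 2 :=
    (hFC.continuous_iteratedDeriv _ (by push_cast; gcongr; norm_num)).pow 2
  have hGc : Continuous fun y => iteratedDeriv (n + 1) G y ^ 2 :=
    (hGC.continuous_iteratedDeriv _ (by push_cast; gcongr; norm_num)).pow 2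
  have iF2 : IntervalIntegrable (fun x => 2 * iteratedDeriv (n + 1) F x ^ 2) volume R X :=
    (continuous_const.mul hFc).intervalIntegrable _ _
  have iG2 : IntervalIntegrable (fun x => 2 * iteratedDeriv (n + 1) G x ^ 2) volume R X :=
    (continuous_const.mul hGc).intervalIntegrable _ _
  have iFG : IntervalIntegrable (fun x => 2 * iteratedDeriv (n + 1) F x ^ 2 + 2 * iteratedDeriv (n + 1) G x ^ 2)
      volume R X := iF2.add iG2
  have hIF : ∫ y in R..X, iteratedDeriv (n + 1) F y ^ 2 ≤ Lp / 2 := by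
    have := intervalIntegral_le_of_zero_Ici hFc (fun y => sq_nonneg _) hX (B := B)
      (fun y hy => by simp [hF0 y hy])
    rw [hLp]; linarith
  have hIG : ∫ y in R..X, iteratedDeriv (n + 1) G y ^ 2 ≤ Lm / 2 := by
    have := intervalIntegral_le_of_zero_Ici hGc (fun y => sq_nonneg _) hX (B := B)
      (fun y hy => by simp [hG0 y hy])
    rw [hLm]; linarith
  -- Step 7: position part
  have hposC : ContDiff ℝ 1 fun y => h y - ∑ k ∈ range (n / 2 + 1), α k * ι y ^ (n - 2 * k) :=
    (hh.of_le (by norm_num)).sub (ContDiff.sum fun k _ => contDiff_const.mul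
      ((hι.of_le (by exact_mod_cast le_top)).pow _))
  have hpos_cont : Continuous fun x => deriv (fun y => h y - ∑ k ∈ range (n / 2 + 1), α k * ι y ^ (n - 2 * k)) x ^ 2
      + (n : ℝ) * (n + 1) * ι x ^ 2 * (h x - ∑ k ∈ range (n / 2 + 1), α k * ι x ^ (n - 2 * k)) ^ 2 :=
    ((hposC.continuous_deriv le_rfl).pow 2).add
      (((continuous_const.mul ((hι.continuous).pow 2)).mul (hposC.continuous.pow 2)))
  have hpos : ∫ x in R..X, (deriv (fun y => h y - ∑ k ∈ range (n / 2 + 1), α k * ι y ^ (n - 2 * k)) x ^ 2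
      + (n : ℝ) * (n + 1) * ι x ^ 2 * (h x - ∑ k ∈ range (n / 2 + 1), α k * ι x ^ (n - 2 * k)) ^ 2)
      ≤ C₁ * (Lp + Lm) := by
    have heq : ∫ x in R..X, (deriv (fun y => h y - ∑ k ∈ range (n / 2 + 1), α k * ι y ^ (n - 2 * k)) x ^ 2
        + (n : ℝ) * (n + 1) * ι x ^ 2 * (h x - ∑ k ∈ range (n / 2 + 1), α k * ι x ^ (n - 2 * k)) ^ 2)
        = ∫ x in R..X, deriv (ladder ι n k₁) x ^ 2
          + (n : ℝ) * (n + 1) * ι x ^ 2 * (ladder ι n k₁ x) ^ 2 := by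
      refine intervalIntegral.integral_congr fun x hx => ?_
      rw [uIcc_of_le hX] at hx
      have hx2 : 1 / 2 < x := by linarith [hx.1]
      have h1 := (hev₁ x hx2).deriv_eq
      have h2 : ladder ι n k₁ x = h x - ∑ k ∈ range (n / 2 + 1), α k * ι x ^ (n - 2 * k) :=
        (hev₁ x hx2).eq_of_nhds
      simp only [h1, h2]
    rw [heq]
    refine hco₁.trans ?_
    have hbd : ∫ x in R..X, iteratedDeriv (n + 1) k₁ x ^ 2
        ≤ 2 * (∫ y in R..X, iteratedDeriv (n + 1) F y ^ 2) + 2 * ∫ y in R..X, iteratedDeriv (n + 1) G y ^ 2 := by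
      rw [← intervalIntegral.integral_const_mul, ← intervalIntegral.integral_const_mul,
        ← intervalIntegral.integral_add iF2 iG2]
      refine intervalIntegral.integral_mono_on hX ?_ ?_ fun x _ => ?_
      · exact ((hk₁C.continuous_iteratedDeriv' (n + 1)).pow 2).intervalIntegrable _ _
      · exact iFG
      · rw [hdk₁ x]
        nlinarith [sq_nonneg (iteratedDeriv (n + 1) F x - iteratedDeriv (n + 1) G x)]
    calc C₁ * ∫ x in R..X, iteratedDeriv (n + 1) k₁ x ^ 2
        ≤ C₁ * (2 * (Lp / 2) + 2 * (Lm / 2)) := by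
          refine mul_le_mul_of_nonneg_left (hbd.trans ?_) hC₁0
          linarith
      _ = C₁ * (Lp + Lm) := by ring
  -- Step 8: velocity part
  have hvel_cont : Continuous fun x => (g x - ∑ k ∈ range ((n + 1) / 2), β k * ι x ^ (n - 2 * k)) ^ 2 :=
    (hg.continuous.sub (continuous_finsetSum _ fun k _ =>
      continuous_const.mul (hι.continuous.pow _))).pow 2
  have hvel : ∫ x in R..X, (g x - ∑ k ∈ range ((n + 1) / 2), β k * ι x ^ (n - 2 * k)) ^ 2
      ≤ C₂ * (Lp + Lm) := by
    have heq : ∫ x in R..X, (g x - ∑ k ∈ range ((n + 1) / 2), β k * ι x ^ (n - 2 * k)) ^ 2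
        = ∫ x in R..X, (ladder ι n k₂ x) ^ 2 := by
      refine intervalIntegral.integral_congr fun x hx => ?_
      rw [uIcc_of_le hX] at hx
      have hx2 : 1 / 2 < x := by linarith [hx.1]
      simp only [hval₂ x hx2]
    rw [heq]
    refine hco₂.trans ?_
    have hbd : ∫ x in R..X, iteratedDeriv n k₂ x ^ 2
        ≤ 2 * (∫ y in R..X, iteratedDeriv (n + 1) F y ^ 2) + 2 * ∫ y in R..X, iteratedDeriv (n + 1) G y ^ 2 := by
      rw [← intervalIntegral.integral_const_mul, ← intervalIntegral.integral_const_mul,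
        ← intervalIntegral.integral_add iF2 iG2]
      refine intervalIntegral.integral_mono_on hX ?_ ?_ fun x _ => ?_
      · exact ((hk₂C.continuous_iteratedDeriv' n).pow 2).intervalIntegrable _ _
      · exact iFG
      · rw [hdk₂ x]
        nlinarith [sq_nonneg (iteratedDeriv (n + 1) F x + iteratedDeriv (n + 1) G x)]
    calc C₂ * ∫ x in R..X, iteratedDeriv n k₂ x ^ 2
        ≤ C₂ * (2 * (Lp / 2) + 2 * (Lm / 2)) := by
          refine mul_le_mul_of_nonneg_left (hbd.trans ?_) hC₂0
          linarith
      _ = C₂ * (Lp + Lm) := by ring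
  -- Step 9: combine
  rw [intervalIntegral.integral_add (hpos_cont.intervalIntegrable _ _) (hvel_cont.intervalIntegrable _ _)]
  calc _ ≤ C₁ * (Lp + Lm) + C₂ * (Lp + Lm) := add_le_add hpos hvel
    _ = (C₁ + C₂) * (Lp + Lm) := by ring

end Main

end Literature.Analysis.PDE
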